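import Literature.NumberTheory.LFunctions.Zhang2022.RepairGapLemma82Premise
import Literature.NumberTheory.LFunctions.Zhang2022.RepairGapPartIIIDoors
import Literature.NumberTheory.LFunctions.Zhang2022.Section12Lemma121
import HarnessLib

/-!
# Zhang (2022), rescue GAP/BED (D-0124 (3)(4)): the closed form of Lemma 12.1's first displayed line on ALL `1 ≤ d < P₂`
# under the minimum premise `‖L(1,χ)‖ ≤ 𝓛⁻¹⁵` (companion of `RepairGapSection12U020Premise`)

Topic `Literature/NumberTheory/LFunctions/Zhang2022` (Landau–Siegel audit tree; verdict-neutral).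
Y. Zhang, *Discrete mean estimates and the Landau–Siegel zero*, arXiv:2211.02515v1 (2022)
[Zhang2022LandauSiegel] — **an unrefereed manuscript under adjudication; nothing in this file asserts or
denies its Theorems 1–2, and nothing here is a claim about Landau–Siegel zeros. The programme SEARCHES and
TYPES; no claim about Landau–Siegel zeros, Theorems 1–2 of arXiv:2211.02515 or a repaired Margin232 until a
kernel theorem says so.**

The tree's `Typed.Sec12B.line020_closed_form` (§12, proof of Lemma 12.1, p. 68): for all large `D` under the printed (A),
`‖line020(d) − (L′(1,χ)(d/P″₁)^{−β₆}/log P₁)(−1 + (β₆ − β_j)log(d/P″₁))‖ ≤ C𝓛⁻¹⁵` for every `1 ≤ d < P₂`, `j ∈ {1,2,3}` —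
the estimate inside `U020_holds` (ii) with `X = P″₂/d ≤ P` taken from `d ≥ 1`; it is the input for the range `P″₁/T < d ≤ P″₁`
(`Section12Lemma121Ranges`). Its two uses of (A) are the Lemma 8.2 core and Lemma 5.8 at `1 + δ`, exactly as in u020. This
file re-runs it VERBATIM with those calls re-pointed to `Repair.Gap.sum_twist_log_sub_main_le_pow15` (p566965) and
`Repair.Gap.lemma58_of_norm_le_pow15` (p561913): the closed form holds, SAME constant `C = (0.004·C₅₈ + 1 + C₈₂)/0.504` and
threshold, for all large `D` and every real primitive `χ (mod D)` with `‖L(1,χ)‖ ≤ 𝓛⁻¹⁵`; hence under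
`Repair.Bed.AssumptionAWith E` for every real `E ≥ 15` (at `E = 2022` the transfer lemma returns the tree statement, not
restated). The tree-private helpers `inner_identity`, `inner_bound`, `betaJ_re_and_norm` are repeated privately.
GAP G-31 context only. Theorems only; no definition, no named fact; nothing about (A) itself.

## References

* Y. Zhang, arXiv:2211.02515v1 (2022), §12 proof of Lemma 12.1 p. 68; §8 Lemma 8.2; §5 Lemma 5.8.
  [cite: Zhang2022LandauSiegel, §12 proof of Lemma 12.1, p. 68]
-/

noncomputable section

open Complex Real ComplexConjugate

namespace Literature.NumberTheory.LFunctions.Zhang2022.Typed.Sec12B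

open Literature.NumberTheory.LFunctions.Zhang2022.Skeleton
open Literature.NumberTheory.LFunctions.Zhang2022.Repair.Bed (AssumptionAWith)

section ClosedFormPowFifteen

/-- The algebra of the comparison (tree-private, repeated): with `u + log X = Λ`,
`u·A + (log X·A − B) − L′(−1 + δu) = Λ(A − L′δ) − (B − L′(1 + δ log X))`. [folklore] -/
private theorem inner_identity (A Bt L1 δ : ℂ) {u lX Λ : ℝ} (h : u + lX = Λ) :
    (u : ℂ) * A + ((lX : ℂ) * A - Bt) - L1 * (-1 + δ * (u : ℂ)) =
      (Λ : ℂ) * (A - L1 * δ) - (Bt - L1 * (1 + δ * (lX : ℂ))) := by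
  have : (u : ℂ) = (Λ : ℂ) - (lX : ℂ) := by rw [← h]; push_cast; ring
  rw [this]; ring

/-- The triangle inequality for the comparison (tree-private, repeated). [folklore] -/
private theorem inner_bound {A Bt L1 Lv δ : ℂ} {lX Λ a b c : ℝ} (hΛ : 0 ≤ Λ)
    (ha : ‖A - Lv‖ ≤ a) (hb : ‖Lv - L1 * δ‖ ≤ b) (hc : ‖Bt - L1 * (1 + δ * (lX : ℂ))‖ ≤ c) :
    ‖(Λ : ℂ) * (A - L1 * δ) - (Bt - L1 * (1 + δ * (lX : ℂ)))‖ ≤ Λ * (a + b) + c := by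
  have hAδ : ‖A - L1 * δ‖ ≤ a + b := by
    calc ‖A - L1 * δ‖ = ‖(A - Lv) + (Lv - L1 * δ)‖ := by congr 1; ring
      _ ≤ ‖A - Lv‖ + ‖Lv - L1 * δ‖ := norm_add_le _ _
      _ ≤ a + b := add_le_add ha hb
  calc ‖(Λ : ℂ) * (A - L1 * δ) - (Bt - L1 * (1 + δ * (lX : ℂ)))‖
      ≤ ‖(Λ : ℂ) * (A - L1 * δ)‖ + ‖Bt - L1 * (1 + δ * (lX : ℂ))‖ := norm_sub_le _ _
    _ ≤ Λ * (a + b) + c := by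
        rw [norm_mul, Complex.norm_real, Real.norm_eq_abs, abs_of_nonneg hΛ]
        exact add_le_add (mul_le_mul_of_nonneg_left hAδ hΛ) hc

/-- `Re β_j = 0` and `‖β_j‖ ≤ (3 + 5|c′|)π𝓛⁻⁹` for `j ∈ {1,2,3}`, `log D ≥ 2` (tree-private, repeated).
[cite: Zhang2022LandauSiegel, §2 (2.13)] -/
private theorem betaJ_re_and_norm (c' : ℝ) {D : ℕ} (hL : 2 ≤ Real.log D) {j : ℕ}
    (hj : j ∈ ({1, 2, 3} : Finset ℕ)) :
    (betaJ c' D j).re = 0 ∧ ‖betaJ c' D j‖ ≤ (3 + 5 * |c'|) * (π / Real.log D ^ 9) := by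
  have hπ := Real.pi_pos
  have hL0 : 0 < Real.log D := by linarith
  have hα : alpha D = π / Real.log D ^ 9 := by rw [alpha, bigP, Real.log_exp, ell]
  set a : ℝ := π / Real.log D ^ 9 with ha
  have ha0 : 0 < a := by positivity
  have hell : ell D = Real.log D := rfl
  -- `α𝓛 = π/𝓛⁸ ≤ π/2⁸ ≤ 1`
  have haL : a * Real.log D ≤ 1 := by
    have h8 : (2 : ℝ) ^ 8 ≤ Real.log D ^ 8 := pow_le_pow_left₀ (by norm_num) hL 8
    have hπ4 : π ≤ 4 := Real.pi_le_four
    rw [ha, div_mul_eq_mul_div, div_le_one (by positivity)]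
    calc π * Real.log D ≤ 4 * Real.log D := by nlinarith
      _ ≤ 2 ^ 8 * Real.log D := by nlinarith
      _ ≤ Real.log D ^ 8 * Real.log D := by nlinarith
      _ = Real.log D ^ 9 := by ring
  have haL0 : 0 ≤ a * Real.log D := by positivity
  have hc0 : 0 ≤ |c'| := abs_nonneg _
  have hcaL : |c'| * (a * Real.log D) ≤ |c'| := by nlinarith
  simp only [Finset.mem_insert, Finset.mem_singleton] at hj
  rcases hj with rfl | rfl | rfl
  · have he : betaJ c' D 1 = ((a * (1 - 5 * c' * a * Real.log D) : ℝ) : ℂ) * I := by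
      simp only [betaJ, Nat.reduceMod, if_true, beta1, hα, hell]
      push_cast; ring
    refine ⟨by rw [he]; exact Lemma82.re_ofReal_mul_I _, ?_⟩
    rw [he, Lemma82.norm_ofReal_mul_I, abs_mul, abs_of_pos ha0]
    have h1 : |1 - 5 * c' * a * Real.log D| ≤ 1 + 5 * |c'| := by
      calc |1 - 5 * c' * a * Real.log D| ≤ |(1 : ℝ)| + |5 * c' * a * Real.log D| := abs_sub _ _
        _ = 1 + 5 * (|c'| * (a * Real.log D)) := by
            rw [abs_one, show 5 * c' * a * Real.log D = 5 * (c' * (a * Real.log D)) by ring,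
              abs_mul, abs_mul, abs_of_nonneg haL0, abs_of_pos (by norm_num : (0 : ℝ) < 5)]
        _ ≤ 1 + 5 * |c'| := by linarith
    nlinarith
  · have he : betaJ c' D 2 = ((2 * a * (1 + c' * a * Real.log D) : ℝ) : ℂ) * I := by
      simp only [betaJ, Nat.reduceMod, beta2, hα, hell]
      norm_num; ring
    refine ⟨by rw [he]; exact Lemma82.re_ofReal_mul_I _, ?_⟩
    rw [he, Lemma82.norm_ofReal_mul_I, abs_mul, abs_of_pos (by positivity : (0 : ℝ) < 2 * a)]
    have h1 : |1 + c' * a * Real.log D| ≤ 1 + |c'| := by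
      calc |1 + c' * a * Real.log D| ≤ |(1 : ℝ)| + |c' * a * Real.log D| := abs_add_le _ _
        _ = 1 + |c'| * (a * Real.log D) := by
            rw [abs_one, show c' * a * Real.log D = c' * (a * Real.log D) by ring, abs_mul,
              abs_of_nonneg haL0]
        _ ≤ 1 + |c'| := by linarith
    nlinarith
  · have he : betaJ c' D 3 = ((3 * a * (1 - c' * a * Real.log D) : ℝ) : ℂ) * I := by
      simp only [betaJ, Nat.reduceMod, beta3, hα, hell]
      norm_num; ring
    refine ⟨by rw [he]; exact Lemma82.re_ofReal_mul_I _, ?_⟩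
    rw [he, Lemma82.norm_ofReal_mul_I, abs_mul, abs_of_pos (by positivity : (0 : ℝ) < 3 * a)]
    have h1 : |1 - c' * a * Real.log D| ≤ 1 + |c'| := by
      calc |1 - c' * a * Real.log D| ≤ |(1 : ℝ)| + |c' * a * Real.log D| := abs_sub _ _
        _ = 1 + |c'| * (a * Real.log D) := by
            rw [abs_one, show c' * a * Real.log D = c' * (a * Real.log D) by ring, abs_mul,
              abs_of_nonneg haL0]
        _ ≤ 1 + |c'| := by linarith
    nlinarith

variable (c' : ℝ)

/-- **The first displayed line in closed form for ALL `1 ≤ d < P₂` under the minimum premise** (twin of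
`Typed.Sec12B.line020_closed_form`, same constant and threshold): for all large `D` and every real primitive `χ (mod D)`
with `‖L(1,χ)‖ ≤ 𝓛⁻¹⁵`, `j ∈ {1,2,3}`, `1 ≤ d < P₂`:
`‖line020(d) − (L′(1,χ)(d/P″₁)^{−β₆}/log P₁)(−1 + (β₆ − β_j)log(d/P″₁))‖ ≤ C𝓛⁻¹⁵`.
[cite: Zhang2022LandauSiegel, §12 proof of Lemma 12.1, p. 68] -/
theorem line020_closed_form_pow15 : ∃ C : ℝ, ForAllLarge fun D _ χ => ‖χ.LFunction 1‖ ≤ 1 / Real.log D ^ 15 →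
    ∀ j ∈ ({1, 2, 3} : Finset ℕ), ∀ d : ℕ, 1 ≤ d → (d : ℝ) < Skeleton.P2 D →
      ‖line020 c' χ j d -
          deriv χ.LFunction 1 * ((d / P1pp D : ℝ) : ℂ) ^ (-beta6 D) /
              (Real.log (Skeleton.P1 D) : ℂ) *
            (-1 + (beta6 D - betaJ c' D j) * (Real.log (d / P1pp D) : ℂ))‖ ≤
        C * (ell D ^ 15)⁻¹ := by
  set K : ℝ := 2 * (3 + 5 * |c'|) with hKdef
  have hK0 : 0 ≤ K := by rw [hKdef]; positivity
  set C58 : ℝ := 1 + 16 * Real.exp (9 / 2) * π ^ 2 * K ^ 2 with hC58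
  set CE : ℝ := 0.004 * C58 + 1 + Lemma82.C82 K with hCE
  refine ⟨CE / 0.504, ⌈Real.exp (4 * K * π + 3)⌉₊,
    fun D _ χ hD hq hp h15 j hj d hd hd2 => ?_⟩
  have hπ := Real.pi_pos
  -- `D` large: `𝓛 ≥ 3`, `4Kπ ≤ 𝓛 ≤ 𝓛⁸`
  have hD0 : (0 : ℝ) < D := lt_of_lt_of_le (Real.exp_pos _)
    (le_trans (Nat.le_ceil _) (by exact_mod_cast hD))
  have hexp : Real.exp (4 * K * π + 3) ≤ D := le_trans (Nat.le_ceil _) (by exact_mod_cast hD)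
  have hlogD : 4 * K * π + 3 ≤ Real.log D := (Real.le_log_iff_exp_le hD0).mpr hexp
  have hKπ : 0 ≤ 4 * K * π := by positivity
  have hL3 : 3 ≤ Real.log D := by linarith only [hlogD, hKπ]
  have hL1 : 1 ≤ Real.log D := by linarith only [hL3]
  have hL0 : 0 < Real.log D := by linarith only [hL3]
  have hK8 : 4 * K * π ≤ Real.log D ^ 8 := by
    calc 4 * K * π ≤ Real.log D := by linarith only [hlogD]
      _ = Real.log D ^ 1 := (pow_one _).symm
      _ ≤ Real.log D ^ 8 := pow_le_pow_right₀ hL1 (by norm_num)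
  have hK1 : K * π ≤ Real.log D ^ 8 := by nlinarith only [hK8, hK0, hπ]
  have hD3 : 3 ≤ D := by
    have h3 : Real.exp 3 ≤ Real.exp (4 * K * π + 3) := Real.exp_le_exp.mpr (by linarith only [hKπ])
    have h4 : (3 : ℝ) + 1 ≤ Real.exp 3 := Real.add_one_le_exp 3
    have : (3 : ℝ) ≤ D := by linarith only [h3, h4, hexp]
    exact_mod_cast this
  have hD2 : 2 ≤ D := le_trans (by norm_num) hD3
  have hχ1 : χ ≠ 1 := Lemma31.ne_one_of_isPrimitive χ hD2 hp
  have hell : ell D = Real.log D := rfl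
  have hC82 : 0 ≤ Lemma82.C82 K := by
    have := Lemma82.I0_nonneg
    rw [Lemma82.C82]; positivity
  have hCE0 : 0 ≤ CE := by rw [hCE]; positivity
  -- the closed form (the body of `U020_holds` (ii), with `X ≤ P` from `d ≥ 1` instead of `d > P″₁`)
  -- parameters of the setting
  have hα : alpha D = π / Real.log D ^ 9 := by rw [alpha, bigP, Real.log_exp, hell]
  have hP : 0 < bigP D := Real.exp_pos _
  have hP1' : 1 ≤ bigP D := Real.one_le_exp (by rw [hell]; positivity)
  have hlogP1 : Real.log (Skeleton.P1 D) = 0.504 * Real.log D ^ 9 := by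
    rw [Skeleton.P1, Real.log_rpow hP, bigP, Real.log_exp, hell]
  have hP1pp : 0 < P1pp D := P1pp_pos hD3
  have hP2pp : 0 < P2pp D := P2pp_pos hD3
  have hd0 : (0 : ℝ) < d := by exact_mod_cast hd
  have hDr : (3 : ℝ) ≤ D := by exact_mod_cast hD3
  have ht0 : 1 ≤ t0 D := by rw [t0, hell]; exact one_le_pow₀ hL1
  have ht0eq : t0 D = Real.log D ^ 519 := by rw [t0, hell]
  have hT1 : 1 ≤ bigT D := Real.one_le_exp (by rw [hell]; positivity)
  have hT2 : 2 ≤ bigT D := by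
    have h1 : (1 : ℝ) ≤ Real.log D ^ (1.1 : ℝ) := Real.one_le_rpow hL1 (by norm_num)
    have h2 : Real.exp 1 ≤ Real.exp (Real.log D ^ (1.1 : ℝ)) := Real.exp_le_exp.mpr h1
    have h3 : (1 : ℝ) + 1 ≤ Real.exp 1 := Real.add_one_le_exp 1
    rw [bigT, hell]; linarith only [h2, h3]
  have hDt0 : 1 ≤ (D : ℝ) * t0 D := one_le_mul_of_one_le_of_one_le (by linarith only [hDr]) ht0
  obtain ⟨X, hX⟩ : ∃ X : ℝ, X = P2pp D / d := ⟨_, rfl⟩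
  have hXlow : bigT D ^ 10 * ((D : ℝ) * t0 D) < X := by
    have h1 : (d : ℝ) * bigT D ^ 10 < bigP D ^ (0.5 : ℝ) := by
      have := hd2
      rw [Skeleton.P2, lt_div_iff₀ (by positivity)] at this
      exact this
    rw [hX, lt_div_iff₀ hd0, P2pp]
    have hpos : (0 : ℝ) < (D : ℝ) * t0 D := by linarith only [hDt0]
    calc bigT D ^ 10 * ((D : ℝ) * t0 D) * d = ((d : ℝ) * bigT D ^ 10) * ((D : ℝ) * t0 D) := by
          ring
      _ < bigP D ^ (0.5 : ℝ) * ((D : ℝ) * t0 D) := mul_lt_mul_of_pos_right h1 hpos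
      _ = bigP D ^ (0.5 : ℝ) * D * t0 D := by ring
  have hXT : bigT D ≤ X := by
    calc bigT D = bigT D ^ 1 * 1 := by ring
      _ ≤ bigT D ^ 10 * ((D : ℝ) * t0 D) :=
          mul_le_mul (pow_le_pow_right₀ hT1 (by norm_num)) hDt0 zero_le_one (by positivity)
      _ ≤ X := hXlow.le
  have hX2 : 2 ≤ X := le_trans hT2 hXT
  have hX0 : 0 < X := by linarith only [hX2]
  have hratio : P2pp D / P1pp D = bigP D ^ (0.004 : ℝ) := by
    have hne : (D : ℝ) * t0 D ≠ 0 := by positivity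
    have h1 : P2pp D / P1pp D = bigP D ^ (0.5 : ℝ) / bigP D ^ (0.496 : ℝ) := by
      rw [P2pp, P1pp, mul_assoc, mul_assoc, mul_div_mul_right _ _ hne]
    rw [h1, ← Real.rpow_sub hP]
    norm_num
  have hXP : X ≤ bigP D := by
    -- `X = P″₂/d ≤ P″₂ = P^{1/2}·D·𝓛⁵¹⁹ ≤ P` (`d ≥ 1`, `𝓛 ≥ 3`)
    have h1 : X ≤ P2pp D := by rw [hX]; exact div_le_self hP2pp.le (by exact_mod_cast hd)
    have hlogL : Real.log (Real.log D) ≤ Real.log D := by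
      have := Real.log_le_sub_one_of_pos hL0; linarith only [this]
    have hlogP2pp : Real.log (P2pp D) = 0.5 * Real.log D ^ 9 + Real.log D +
        519 * Real.log (Real.log D) := by
      have ht0' : 0 < t0 D := by rw [t0, hell]; positivity
      rw [P2pp, Real.log_mul (by positivity) ht0'.ne',
        Real.log_mul (Real.rpow_pos_of_pos hP _).ne' hD0.ne', Real.log_rpow hP, bigP, Real.log_exp,
        t0, Real.log_pow, hell]
      push_cast; ring
    have hL9big : 520 * Real.log D ≤ 0.5 * Real.log D ^ 9 := by
      have h8 : (3 : ℝ) ^ 8 ≤ Real.log D ^ 8 := pow_le_pow_left₀ (by norm_num) hL3 8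
      nlinarith only [h8, hL0]
    have h2 : Real.log (P2pp D) ≤ Real.log (bigP D) := by
      rw [hlogP2pp, bigP, Real.log_exp, hell]; nlinarith only [hlogL, hL9big, hL0]
    exact h1.trans ((Real.log_le_log_iff hP2pp hP).mp h2)
  obtain ⟨u, hu⟩ : ∃ u : ℝ, u = Real.log ((d : ℝ) / P1pp D) := ⟨_, rfl⟩
  have hdP : 0 < (d : ℝ) / P1pp D := div_pos hd0 hP1pp
  have hΛ : u + Real.log X = 0.004 * Real.log D ^ 9 := by
    rw [hu, ← Real.log_mul hdP.ne' hX0.ne']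
    have : (d : ℝ) / P1pp D * X = P2pp D / P1pp D := by
      rw [hX]; field_simp
    rw [this, hratio, Real.log_rpow hP, bigP, Real.log_exp, hell]
  -- the shifts
  obtain ⟨δ, hδdef⟩ : ∃ δ : ℂ, δ = beta6 D - betaJ c' D j := ⟨_, rfl⟩
  have he' : 1 + beta6 D - betaJ c' D j = 1 + δ := by rw [hδdef]; ring
  obtain ⟨hβjre, hβjn⟩ := betaJ_re_and_norm c' (by linarith only [hL3]) hj
  have hβ6eq : beta6 D = ((3 / 2 * (π / Real.log D ^ 9) : ℝ) : ℂ) * I := by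
    rw [beta6, hα]; push_cast; ring
  have hβ6re : (beta6 D).re = 0 := by rw [hβ6eq]; exact Lemma82.re_ofReal_mul_I _
  have hβ6n : ‖beta6 D‖ ≤ (3 + 5 * |c'|) * (π / Real.log D ^ 9) := by
    rw [hβ6eq, Lemma82.norm_ofReal_mul_I, abs_of_pos (by positivity)]
    have h0 : 0 ≤ π / Real.log D ^ 9 := by positivity
    have hc0 : 0 ≤ |c'| := abs_nonneg _
    nlinarith only [h0, hc0]
  have hδre : δ.re = 0 := by rw [hδdef, Complex.sub_re, hβ6re, hβjre, sub_zero]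
  have hδ : ‖δ‖ ≤ K * π / Real.log D ^ 9 := by
    rw [hδdef]
    calc ‖beta6 D - betaJ c' D j‖ ≤ ‖beta6 D‖ + ‖betaJ c' D j‖ := norm_sub_le _ _
      _ ≤ (3 + 5 * |c'|) * (π / Real.log D ^ 9) + (3 + 5 * |c'|) * (π / Real.log D ^ 9) :=
          add_le_add hβ6n hβjn
      _ = K * π / Real.log D ^ 9 := by rw [hKdef]; ring
  have hδ1 : ‖δ‖ ≤ 1 := by
    refine hδ.trans ?_
    rw [div_le_one (by positivity)]
    have h9 : Real.log D ^ 8 ≤ Real.log D ^ 9 := pow_le_pow_right₀ hL1 (by norm_num)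
    linarith only [h9, hK1]
  have hre1 : (1 + δ).re = 1 := by
    rw [Complex.add_re, Complex.one_re, hδre, add_zero]
  have hs : 0 < (1 + δ).re := by rw [hre1]; exact one_pos
  have hn1δ : ‖(1 : ℂ) + δ‖ ≤ 2 := by
    have h := norm_add_le (1 : ℂ) δ
    rw [norm_one] at h
    linarith only [h, hδ1]
  -- (b2) `N = ⌈X⌉ − 1 ≥ X − 1 ≥ X/2`, and `X > Dt₀T¹⁰`
  obtain ⟨N, hN⟩ : ∃ N : ℕ, N = ⌈X⌉₊ - 1 := ⟨_, rfl⟩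
  have hceil2 : 2 ≤ ⌈X⌉₊ := by
    have : (2 : ℝ) ≤ (⌈X⌉₊ : ℝ) := le_trans hX2 (Nat.le_ceil X)
    exact_mod_cast this
  have hN1 : 1 ≤ N := by rw [hN]; omega
  have hNX : X - 1 ≤ (N : ℝ) := by
    have : ((⌈X⌉₊ - 1 : ℕ) : ℝ) = (⌈X⌉₊ : ℝ) - 1 := by
      rw [Nat.cast_sub (by omega)]; simp
    rw [hN, this]; linarith only [Nat.le_ceil X]
  have hN0 : (0 : ℝ) < N := by exact_mod_cast hN1
  have hDt0X : (D : ℝ) * Real.log D ^ 519 ≤ X := by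
    rw [← ht0eq]
    calc (D : ℝ) * t0 D = 1 * ((D : ℝ) * t0 D) := by ring
      _ ≤ bigT D ^ 10 * ((D : ℝ) * t0 D) :=
          mul_le_mul_of_nonneg_right (one_le_pow₀ hT1) (by linarith only [hDt0])
      _ ≤ X := hXlow.le
  -- (a) Lemma 8.2 core at `x = X = P″₂/d`
  have hxT : Real.exp (Real.log D ^ (11 / 10 : ℝ)) ≤ X := by
    have : bigT D = Real.exp (Real.log D ^ (11 / 10 : ℝ)) := by
      rw [bigT, hell]; norm_num
    rw [← this]; exact hXT
  have hxP : X ≤ Real.exp (Real.log D ^ 9) := by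
    have : bigP D = Real.exp (Real.log D ^ 9) := by rw [bigP, hell]
    rw [← this]; exact hXP
  have hB := Repair.Gap.sum_twist_log_sub_main_le_pow15 χ hp hL3 h15 hK0 hK8 hδre hδ hxT hxP
  -- (b1) Lemma 5.8 at `s = 1 + δ`
  have h58 := Repair.Gap.lemma58_of_norm_le_pow15 χ hp hL3 h15 (K := K) hK1 (s := 1 + δ)
    (by rw [add_sub_cancel_left]; exact hδ)
  rw [add_sub_cancel_left] at h58
  -- (b2) the tail of the Dirichlet series of `L(1+δ,χ)`
  have htail := RichertFromExpSum.norm_LFunction_sub_sum_range_le χ hχ1 hs hN1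
  rw [hre1, Real.rpow_neg_one, div_one] at htail
  have hDN : (D : ℝ) * (N : ℝ)⁻¹ * (1 + ‖(1 : ℂ) + δ‖) ≤ 6 / Real.log D ^ 519 := by
    have h3 : (1 : ℝ) + ‖(1 : ℂ) + δ‖ ≤ 3 := by linarith only [hn1δ]
    calc (D : ℝ) * (N : ℝ)⁻¹ * (1 + ‖(1 : ℂ) + δ‖) ≤ (D : ℝ) * (N : ℝ)⁻¹ * 3 :=
          mul_le_mul_of_nonneg_left h3 (by positivity)
      _ = 3 * D / N := by ring
      _ ≤ 6 / Real.log D ^ 519 := by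
          rw [div_le_div_iff₀ hN0 (by positivity)]
          linarith only [hDt0X, hNX, hX2]
  have hAeq := sum_Ico_ceil_eq_sum_range χ X δ (rfl : (1 : ℂ) + δ = 1 + δ)
  rw [← hN] at hAeq
  have hAtail : ‖(∑ l ∈ Finset.Ico 1 ⌈X⌉₊, χ (l : ZMod D) / (l : ℂ) ^ (1 + δ)) -
      χ.LFunction (1 + δ)‖ ≤ 6 / Real.log D ^ 519 := by
    rw [norm_sub_rev, hAeq]; exact htail.trans hDN
  -- the inner comparison
  have key := inner_bound (Λ := 0.004 * Real.log D ^ 9) (by positivity) hAtail h58 hB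
  have hL6 : 0 < Real.log D ^ 6 := by positivity
  have key2 : 0.004 * Real.log D ^ 9 * (6 / Real.log D ^ 519 + C58 / Real.log D ^ 15) +
      Lemma82.C82 K / Real.log D ^ 6 ≤ CE / Real.log D ^ 6 := by
    have hsmall : 0.004 * Real.log D ^ 9 * (6 / Real.log D ^ 519) ≤ 1 / Real.log D ^ 6 := by
      rw [show 0.004 * Real.log D ^ 9 * (6 / Real.log D ^ 519) = 0.024 / Real.log D ^ 510 by
        field_simp; ring]
      rw [div_le_div_iff₀ (by positivity) hL6]
      have : Real.log D ^ 6 ≤ Real.log D ^ 510 := pow_le_pow_right₀ hL1 (by norm_num)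
      nlinarith only [this, hL6]
    have hmid : 0.004 * Real.log D ^ 9 * (C58 / Real.log D ^ 15) =
        0.004 * C58 / Real.log D ^ 6 := by
      field_simp
    calc 0.004 * Real.log D ^ 9 * (6 / Real.log D ^ 519 + C58 / Real.log D ^ 15) +
          Lemma82.C82 K / Real.log D ^ 6
        = 0.004 * Real.log D ^ 9 * (6 / Real.log D ^ 519) +
            0.004 * Real.log D ^ 9 * (C58 / Real.log D ^ 15) + Lemma82.C82 K / Real.log D ^ 6 := by
          ring
      _ ≤ 1 / Real.log D ^ 6 + 0.004 * C58 / Real.log D ^ 6 + Lemma82.C82 K / Real.log D ^ 6 := by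
          rw [hmid]; linarith only [hsmall]
      _ = CE / Real.log D ^ 6 := by rw [hCE]; ring
  -- the prefactor has norm `1/log P₁ = 1/(0.504 𝓛⁹)`
  have hcd : ‖(((d : ℝ) / P1pp D : ℝ) : ℂ) ^ (-beta6 D)‖ = 1 := by
    rw [Complex.norm_cpow_eq_rpow_re_of_pos hdP, Complex.neg_re, hβ6re, neg_zero,
      Real.rpow_zero]
  have hlP : ‖(Real.log (Skeleton.P1 D) : ℂ)‖ = 0.504 * Real.log D ^ 9 := by
    rw [Complex.norm_real, Real.norm_eq_abs, hlogP1, abs_of_pos (by positivity)]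
  -- assemble
  rw [line020_eq_mul, ← hX, he', ← hδdef, ← hu, sum_log_eq_log_mul_sub_twist χ hX0 δ rfl]
  have hm : deriv χ.LFunction 1 * (((d : ℝ) / P1pp D : ℝ) : ℂ) ^ (-beta6 D) /
        (Real.log (Skeleton.P1 D) : ℂ) * (-1 + δ * (u : ℂ)) =
      (((d : ℝ) / P1pp D : ℝ) : ℂ) ^ (-beta6 D) / (Real.log (Skeleton.P1 D) : ℂ) *
        (deriv χ.LFunction 1 * (-1 + δ * (u : ℂ))) := by ring
  rw [hm, ← mul_sub, norm_mul, inner_identity _ _ _ _ hΛ, norm_div, hcd, hlP, hell]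
  calc 1 / (0.504 * Real.log D ^ 9) *
        ‖((0.004 * Real.log D ^ 9 : ℝ) : ℂ) *
            ((∑ l ∈ Finset.Ico 1 ⌈X⌉₊, χ (l : ZMod D) / (l : ℂ) ^ (1 + δ)) -
              deriv χ.LFunction 1 * δ) -
          ((∑ m ∈ Finset.Ioc 0 ⌊X⌋₊, Lemma82.twist χ δ m * (Real.log (X / m) : ℂ)) -
            deriv χ.LFunction 1 * (1 + δ * (Real.log X : ℂ)))‖
      ≤ 1 / (0.504 * Real.log D ^ 9) * (CE / Real.log D ^ 6) :=
        mul_le_mul_of_nonneg_left (key.trans key2) (by positivity)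
    _ = CE / 0.504 * (Real.log D ^ 15)⁻¹ := by field_simp

/-- **The closed form from Assumption (A) with ANY exponent `E ≥ 15`** (`Repair.Bed.AssumptionAWith E`; printed
`E = 2022`). [cite: Zhang2022LandauSiegel, §12 proof of Lemma 12.1, p. 68] -/
theorem line020_closed_form_of_assumptionAWith {E : ℝ} (hE : 15 ≤ E) :
    ∃ C : ℝ, ForAllLarge fun D _ χ => AssumptionAWith E D χ →
    ∀ j ∈ ({1, 2, 3} : Finset ℕ), ∀ d : ℕ, 1 ≤ d → (d : ℝ) < Skeleton.P2 D →
      ‖line020 c' χ j d -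
          deriv χ.LFunction 1 * ((d / P1pp D : ℝ) : ℂ) ^ (-beta6 D) /
              (Real.log (Skeleton.P1 D) : ℂ) *
            (-1 + (beta6 D - betaJ c' D j) * (Real.log (d / P1pp D) : ℂ))‖ ≤
        C * (ell D ^ 15)⁻¹ := by
  obtain ⟨C, h⟩ := line020_closed_form_pow15 c'
  exact ⟨C, Repair.Gap.forAllLarge_assumptionAWith_of_pow15 hE h⟩

end ClosedFormPowFifteen

end Literature.NumberTheory.LFunctions.Zhang2022.Typed.Sec12B
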